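import Summits.QuantumAdvantage.QuantumAdvantage.Theorems.LinnikCubicClassGroupsDegreeOnePrimesEscapeClassPNTDHInputs
import Literature.NumberTheory.LFunctions.ClassGroupLFunctionNoExceptionalZeroOddDegree
import Literature.NumberTheory.LFunctions.ClassGroupUnsmoothing
import HarnessLib

/-!
# Prime ideals of a class in short intervals, III: unsmoothing a window weight, the odd-degree
# exclusion of exceptional zeros, and the absorption of the secondary terms

Topic `Summits/QuantumAdvantage/QuantumAdvantage/Theorems`, cell B2b-1 (linnik-cubic), PART A (gen 5);
helper for the crux `DegreeOnePrimesEscape` (stmt-QuantumAdvantage-11543) of route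
`LinnikCubicClassGroups`.  HONEST FRAMING: the value of this file is a THEOREM (kernel-checked lemmas)
— NOT summit progress.

Elementary inputs of the short-interval class prime number theorem (file IV):

* `smoothedPsiClass_le_classPsi_sub`, `classPsi_sub_le_smoothedPsiClass` — unsmoothing by
  MONOTONICITY: a weight `0 ≤ g ≤ 1` supported in `(log x, log(x+h))` minorises, and a weight `g ≥ 0`
  equal to `1` on `(log x, log(x+h)]` majorises, the indicator of the norms in `(x, x+h]`:
  `ψ̃_C(g⁻) ≤ ψ_C(x+h) − ψ_C(x) ≤ ψ̃_C(g⁺)` (no `√x`-loss, unlike the long-interval sandwich);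
* `pack_of_le` — clause (1) of the Landau–Page package is monotone in its constant;
* `not_excRegion_of_odd` — in ODD degree, with the constant shrunk below `1/(8·(2n)!)`, NO zero of the
  family lies on the exceptional segment (`classGroupLFunction_ne_zero_of_odd`: Stark for `K` and for the
  quadratic class field of a real class group character);
* `absorb_junk` — for `C ≥ 0`, `0 < θ ≤ 1` there is `a₁ ≥ 1` with `C·Q⁷·(log x + 1)·x^{−θ/4} ≤ 1`
  whenever `Q ≥ 12`, `x ≥ Q^{a₁}` (all secondary terms of file IV are of this shape).
-/

noncomputable section

open Complex Real MeasureTheory Set Filter Topology Finset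
open scoped NumberField nonZeroDivisors

namespace Summit.QuantumAdvantage.QuantumAdvantage.Theorems.DegreeOnePrimesEscape

open Literature.NumberTheory.LFunctions Literature.NumberTheory.LFunctions.NumberField
  Literature.NumberTheory.LFunctions.AbelianDensity

variable {K : Type} [Field K] [NumberField K]

/-! ### Unsmoothing by monotonicity -/

/-- For `n ≤ ⌊x⌋` (`x ≥ 1`): `log n ≤ log x` (also for `n = 0`, where `log 0 = 0 ≤ log x`). [folklore] -/
theorem log_natCast_le_log_of_le_floor {x : ℝ} (hx : 1 ≤ x) {n : ℕ} (hn : n ≤ ⌊x⌋₊) :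
    Real.log (n : ℝ) ≤ Real.log x := by
  rcases Nat.eq_zero_or_pos n with rfl | hn0
  · simp only [Nat.cast_zero, Real.log_zero]; exact Real.log_nonneg hx
  · exact Real.log_le_log (by exact_mod_cast hn0) ((Nat.cast_le.2 hn).trans (Nat.floor_le (by linarith)))

/-- For `⌊x⌋ < n ≤ ⌊x + h⌋` (`x ≥ 1`): `log x < log n ≤ log(x + h)`. [folklore] -/
theorem log_natCast_mem_of_mem_Ioc {x h : ℝ} (hx : 1 ≤ x) {n : ℕ} (hn : n ∈ Finset.Ioc ⌊x⌋₊ ⌊x + h⌋₊) :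
    Real.log x < Real.log (n : ℝ) ∧ Real.log (n : ℝ) ≤ Real.log (x + h) := by
  rw [Finset.mem_Ioc] at hn
  have hxn : x < n := Nat.lt_of_floor_lt hn.1
  have hxh : 0 < x + h := by
    have : (0 : ℝ) < n := by linarith
    have h1 : (n : ℝ) ≤ ⌊x + h⌋₊ := by exact_mod_cast hn.2
    by_contra hle
    rw [not_lt] at hle
    have : ⌊x + h⌋₊ = 0 := Nat.floor_of_nonpos hle
    rw [this] at hn; omega
  refine ⟨Real.log_lt_log (by linarith) hxn, Real.log_le_log (by linarith) ?_⟩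
  exact (Nat.cast_le.2 hn.2).trans (Nat.floor_le hxh.le)

/-- `ψ_C(x+h) − ψ_C(x) = Σ_{⌊x⌋ < n ≤ ⌊x+h⌋} Λ_C(n)` (`h ≥ 0`). [folklore] -/
theorem classPsi_sub_eq_sum (C : ClassGroup (𝓞 K)) {x h : ℝ} (hh : 0 ≤ h) :
    classPsi K C (x + h) - classPsi K C x = ∑ n ∈ Finset.Ioc ⌊x⌋₊ ⌊x + h⌋₊, vonMangoldtClass K C n := by
  unfold classPsi
  have hsub : Finset.Icc 0 ⌊x⌋₊ ⊆ Finset.Icc 0 ⌊x + h⌋₊ :=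
    Finset.Icc_subset_Icc le_rfl (Nat.floor_le_floor (by linarith))
  rw [← Finset.sum_sdiff hsub]
  have hsd : Finset.Icc 0 ⌊x + h⌋₊ \ Finset.Icc 0 ⌊x⌋₊ = Finset.Ioc ⌊x⌋₊ ⌊x + h⌋₊ := by
    ext n; simp only [Finset.mem_sdiff, Finset.mem_Icc, Finset.mem_Ioc]; omega
  rw [hsd]; ring

/-- **Lower unsmoothing.**  If `0 ≤ g ≤ 1`, `g(u) = 0` for `u ≤ log x` and for `u ≥ log(x + h)`
(`x ≥ 1`, `h ≥ 0`), then `ψ̃_C(g) ≤ ψ_C(x + h) − ψ_C(x)`. [folklore] -/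
theorem smoothedPsiClass_le_classPsi_sub (C : ClassGroup (𝓞 K)) {g : ℝ → ℝ} {x h : ℝ} (hx : 1 ≤ x)
    (hh : 0 ≤ h) (hg01 : ∀ u, g u ∈ Icc (0 : ℝ) 1) (hg0 : ∀ u, u ≤ Real.log x → g u = 0)
    (hg1 : ∀ u, Real.log (x + h) ≤ u → g u = 0) :
    smoothedPsiClass K C g ≤ classPsi K C (x + h) - classPsi K C x := by
  set N : ℕ := ⌊x + h⌋₊ + 1 with hN
  have hN1 : 1 ≤ N := by omega
  have hxh : 0 < x + h := by linarith
  have hNlog : Real.log (x + h) ≤ Real.log N := by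
    have h1 : x + h ≤ N := by rw [hN]; push_cast; exact (Nat.lt_floor_add_one _).le
    exact Real.log_le_log hxh h1
  rw [smoothedPsiClass_eq_sum C hg1 hN1 hNlog, classPsi_sub_eq_sum C hh]
  have hrange : Finset.range N = Finset.Icc 0 ⌊x + h⌋₊ := by
    ext n; rw [Finset.mem_range, Finset.mem_Icc, hN]; omega
  rw [hrange]
  have hsub : Finset.Icc 0 ⌊x⌋₊ ⊆ Finset.Icc 0 ⌊x + h⌋₊ :=
    Finset.Icc_subset_Icc le_rfl (Nat.floor_le_floor (by linarith))
  rw [← Finset.sum_sdiff hsub]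
  have hsd : Finset.Icc 0 ⌊x + h⌋₊ \ Finset.Icc 0 ⌊x⌋₊ = Finset.Ioc ⌊x⌋₊ ⌊x + h⌋₊ := by
    ext n; simp only [Finset.mem_sdiff, Finset.mem_Icc, Finset.mem_Ioc]; omega
  rw [hsd]
  have hzero : ∑ n ∈ Finset.Icc 0 ⌊x⌋₊, vonMangoldtClass K C n * g (Real.log n) = 0 := by
    refine Finset.sum_eq_zero fun n hn ↦ ?_
    rw [Finset.mem_Icc] at hn
    rw [hg0 _ (log_natCast_le_log_of_le_floor hx hn.2), mul_zero]
  rw [hzero, add_zero]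
  refine Finset.sum_le_sum fun n _ ↦ ?_
  have h01 := hg01 (Real.log n)
  have h0 := vonMangoldtClass_nonneg (K := K) C n
  nlinarith [h01.2]

/-- **Upper unsmoothing.**  If `g ≥ 0`, `g(u) = 1` for `log x < u ≤ log(x + h)` and `g = 0` on
`[x₀, ∞)` (`x ≥ 1`, `h ≥ 0`), then `ψ_C(x + h) − ψ_C(x) ≤ ψ̃_C(g)`. [folklore] -/
theorem classPsi_sub_le_smoothedPsiClass (C : ClassGroup (𝓞 K)) {g : ℝ → ℝ} {x h x₀ : ℝ} (hx : 1 ≤ x)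
    (hh : 0 ≤ h) (hg0 : ∀ u, 0 ≤ g u)
    (hg1 : ∀ u, Real.log x < u → u ≤ Real.log (x + h) → g u = 1) (hgz : ∀ u, x₀ ≤ u → g u = 0) :
    classPsi K C (x + h) - classPsi K C x ≤ smoothedPsiClass K C g := by
  set N : ℕ := ⌊x + h⌋₊ + ⌈Real.exp x₀⌉₊ + 1 with hN
  have hN1 : 1 ≤ N := by omega
  have hNpos : (0 : ℝ) < N := by exact_mod_cast hN1
  have hNlog : x₀ ≤ Real.log N := by
    rw [Real.le_log_iff_exp_le hNpos]
    have h1 : Real.exp x₀ ≤ ⌈Real.exp x₀⌉₊ := Nat.le_ceil _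
    have h2 : (⌈Real.exp x₀⌉₊ : ℝ) ≤ N := by rw [hN]; push_cast; linarith [Nat.cast_nonneg (α := ℝ) ⌊x + h⌋₊]
    linarith
  rw [smoothedPsiClass_eq_sum C hgz hN1 hNlog, classPsi_sub_eq_sum C hh]
  have hsub : Finset.Ioc ⌊x⌋₊ ⌊x + h⌋₊ ⊆ Finset.range N := by
    intro n hn
    rw [Finset.mem_Ioc] at hn
    rw [Finset.mem_range, hN]; omega
  calc ∑ n ∈ Finset.Ioc ⌊x⌋₊ ⌊x + h⌋₊, vonMangoldtClass K C n
      = ∑ n ∈ Finset.Ioc ⌊x⌋₊ ⌊x + h⌋₊, vonMangoldtClass K C n * g (Real.log n) := by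
        refine Finset.sum_congr rfl fun n hn ↦ ?_
        obtain ⟨h1, h2⟩ := log_natCast_mem_of_mem_Ioc hx hn
        rw [hg1 _ h1 h2, mul_one]
    _ ≤ ∑ n ∈ Finset.range N, vonMangoldtClass K C n * g (Real.log n) :=
        Finset.sum_le_sum_of_subset_of_nonneg hsub fun n _ _ ↦
          mul_nonneg (vonMangoldtClass_nonneg C n) (hg0 _)

/-! ### The Landau–Page package: monotonicity in the constant, and the odd-degree exclusion -/

/-- **Clause (1) of the Landau–Page package is monotone in the constant**: a smaller constant gives a
smaller exceptional region. [folklore] -/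
theorem pack_of_le {c c' : ℝ} (hcc' : c' ≤ c)
    (hpack : ∀ (χ : ClassGroup (𝓞 K) →* ℂˣ) (ρ : ℂ),
      (((χ = 1 → dedekindZeta₁ K ρ = 0) ∧ (χ ≠ 1 → classGroupLFunction₀ K χ ρ = 0)) ∧
        1 - c / (Real.log ((NumberField.discr K).natAbs : ℝ) + Real.log (|ρ.im| + 4)) < ρ.re) →
        ρ.im = 0 ∧ χ * χ = 1) :
    ∀ (χ : ClassGroup (𝓞 K) →* ℂˣ) (ρ : ℂ),
      (((χ = 1 → dedekindZeta₁ K ρ = 0) ∧ (χ ≠ 1 → classGroupLFunction₀ K χ ρ = 0)) ∧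
        1 - c' / (Real.log ((NumberField.discr K).natAbs : ℝ) + Real.log (|ρ.im| + 4)) < ρ.re) →
        ρ.im = 0 ∧ χ * χ = 1 := by
  intro χ ρ ⟨hz, hreg⟩
  refine hpack χ ρ ⟨hz, ?_⟩
  have hℒ : 0 < Real.log ((NumberField.discr K).natAbs : ℝ) + Real.log (|ρ.im| + 4) := by
    have h1 : 0 ≤ Real.log ((NumberField.discr K).natAbs : ℝ) := Real.log_natCast_nonneg _
    have h2 : 0 < Real.log (|ρ.im| + 4) := Real.log_pos (by linarith [abs_nonneg ρ.im])
    linarith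
  have := div_le_div_of_nonneg_right hcc' hℒ.le
  linarith

/-- **No exceptional zeros in odd degree.**  If `[K:ℚ] = n > 1` is ODD, clause (1) of the Landau–Page
package holds with a constant `0 < c ≤ 1/(8·(2n)!)`, then no zero `ρ` of any `F_ψ` with `0 < Re ρ < 1`
lies on the exceptional segment `excRegion c K`: such a zero would be a real zero `β > 1 − c/(log|d_K| + log 4)
≥ 1 − 1/(8(2n)! log|d_K|)` of `L(s, χ_ψ)` with `χ_ψ` real, excluded by
`classGroupLFunction_ne_zero_of_odd`. [cite: Stark1974, Theorem 3] -/
theorem not_excRegion_of_odd (hodd : Odd (Module.finrank ℚ K)) (hK : 1 < Module.finrank ℚ K) {c : ℝ}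
    (hc : 0 < c) (hc8 : c ≤ 1 / (8 * ((2 * Module.finrank ℚ K).factorial : ℝ)))
    (hpack : ∀ (χ : ClassGroup (𝓞 K) →* ℂˣ) (ρ : ℂ),
      (((χ = 1 → dedekindZeta₁ K ρ = 0) ∧ (χ ≠ 1 → classGroupLFunction₀ K χ ρ = 0)) ∧
        1 - c / (Real.log ((NumberField.discr K).natAbs : ℝ) + Real.log (|ρ.im| + 4)) < ρ.re) →
        ρ.im = 0 ∧ χ * χ = 1)
    (ψ : AddChar (Additive (ClassGroup (𝓞 K))) ℂ) {ρ : ℂ} (h0 : famF K ψ ρ = 0) (hρ1 : ρ.re < 1) :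
    ¬ excRegion c K ρ := by
  rintro ⟨him, hre⟩
  set χ : ClassGroup (𝓞 K) →* ℂˣ := (toMulHom ψ).toHomUnits with hχ
  -- the package applies: `ρ` is a zero of the factor `χ` in the region
  have hZ : ((χ = 1 → dedekindZeta₁ K ρ = 0) ∧ (χ ≠ 1 → classGroupLFunction₀ K χ ρ = 0)) ∧
      1 - c / (Real.log ((NumberField.discr K).natAbs : ℝ) + Real.log (|ρ.im| + 4)) < ρ.re := by
    refine ⟨⟨fun h1 ↦ ?_, fun h1 ↦ ?_⟩, by rw [him, abs_zero, zero_add]; exact hre⟩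
    · have hψ : ψ = 0 := by
        by_contra hψ; exact toHomUnits_ne_one hψ h1
      subst hψ; rwa [famF_zero] at h0
    · have hψ : ψ ≠ 0 := fun h ↦ h1 (by rw [hχ, h]; exact toHomUnits_toMulHom_zero)
      rwa [famF_of_ne hψ] at h0
  obtain ⟨-, hreal⟩ := hpack χ ρ hZ
  -- `ρ` is a real zero of `L(s, χ)`
  have hρne : ρ ≠ 1 := fun h ↦ by rw [h] at hρ1; simp at hρ1
  have hLzero := classGroupLFunction_eq_zero_of_famF ψ h0 hρne
  have hρeq : ρ = ((ρ.re : ℝ) : ℂ) := by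
    apply Complex.ext <;> simp [him]
  -- `|d_K| ≥ 3`
  have hd3 : (3 : ℝ) ≤ ((NumberField.discr K).natAbs : ℝ) := by
    have h2 := NumberField.abs_discr_gt_two hK
    rw [Nat.cast_natAbs]
    exact_mod_cast (show (3 : ℤ) ≤ |NumberField.discr K| by omega)
  have hlogd : 0 < Real.log ((NumberField.discr K).natAbs : ℝ) := Real.log_pos (by linarith)
  have hlog4 : 0 < Real.log 4 := Real.log_pos (by norm_num)
  have hσ : 1 - 1 / (8 * ((2 * Module.finrank ℚ K).factorial : ℝ) *
      Real.log ((NumberField.discr K).natAbs : ℝ)) ≤ ρ.re := by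
    have h1 : c / (Real.log ((NumberField.discr K).natAbs : ℝ) + Real.log 4) ≤
        c / Real.log ((NumberField.discr K).natAbs : ℝ) :=
      div_le_div_of_nonneg_left hc.le hlogd (by linarith)
    have h2 : c / Real.log ((NumberField.discr K).natAbs : ℝ) ≤
        (1 / (8 * ((2 * Module.finrank ℚ K).factorial : ℝ))) / Real.log ((NumberField.discr K).natAbs : ℝ) :=
      div_le_div_of_nonneg_right hc8 hlogd.le
    have h3 : (1 / (8 * ((2 * Module.finrank ℚ K).factorial : ℝ))) / Real.log ((NumberField.discr K).natAbs : ℝ) =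
        1 / (8 * ((2 * Module.finrank ℚ K).factorial : ℝ) * Real.log ((NumberField.discr K).natAbs : ℝ)) := by
      rw [div_div]
    linarith
  have hne := classGroupLFunction_ne_zero_of_odd K hodd hK χ hreal hσ hρ1
  rw [hρeq] at hLzero
  exact hne hLzero

/-! ### Absorption of the secondary terms -/

/-- **Absorption lemma.**  For `C ≥ 0` and `0 < θ ≤ 1` there is `a₁ ≥ 1` such that
`C · Q⁷ · (log x + 1) · x^{−θ/4} ≤ 1` for all `Q ≥ 12` and `x ≥ Q^{a₁}`
(`Q⁷ ≤ x^{θ/16}` once `a₁ ≥ 112/θ`; `log x + 1 ≤ (16/θ) x^{θ/16}`; `x^{θ/8} ≥ e^{a₁θ/4} ≥ 16C/θ + 1`). [folklore] -/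
theorem absorb_junk (C θ : ℝ) (hC : 0 ≤ C) (hθ : 0 < θ) (hθ1 : θ ≤ 1) :
    ∃ a₁ : ℝ, 1 ≤ a₁ ∧ ∀ Q x : ℝ, 12 ≤ Q → Q ^ a₁ ≤ x →
      C * Q ^ (7 : ℕ) * (Real.log x + 1) * x ^ (-(θ / 4)) ≤ 1 := by
  set a₁ : ℝ := max (112 / θ) (4 / θ * Real.log (16 * C / θ + 1)) with ha₁
  have ha112 : 112 / θ ≤ a₁ := le_max_left _ _
  have halog : 4 / θ * Real.log (16 * C / θ + 1) ≤ a₁ := le_max_right _ _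
  have hθinv : 1 ≤ 1 / θ := by rw [le_div_iff₀ hθ]; linarith
  have h112 : (1 : ℝ) ≤ 112 / θ := by rw [le_div_iff₀ hθ]; linarith
  have ha1 : 1 ≤ a₁ := h112.trans ha112
  refine ⟨a₁, ha1, fun Q x hQ hx ↦ ?_⟩
  have hQ0 : 0 < Q := by linarith
  have hQ1 : (1 : ℝ) ≤ Q := by linarith
  have hQa : Q ≤ Q ^ a₁ := by
    conv_lhs => rw [← Real.rpow_one Q]
    exact Real.rpow_le_rpow_of_exponent_le hQ1 ha1
  have hx12 : 12 ≤ x := by linarith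
  have hx1 : 1 ≤ x := by linarith
  have hx0 : 0 < x := by linarith
  have hlog12 : (2 : ℝ) ≤ Real.log 12 := by
    rw [Real.le_log_iff_exp_le (by norm_num)]
    have := Real.exp_one_lt_d9
    have h : Real.exp 2 = Real.exp 1 * Real.exp 1 := by rw [← Real.exp_add]; norm_num
    rw [h]; nlinarith [Real.exp_pos (1:ℝ)]
  have hlogQ : 2 ≤ Real.log Q := hlog12.trans (Real.log_le_log (by norm_num) hQ)
  set L : ℝ := Real.log x with hL
  have hLa : a₁ * Real.log Q ≤ L := by
    have := Real.log_le_log (by positivity) hx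
    rwa [Real.log_rpow hQ0] at this
  have hL0 : 0 < L := by nlinarith
  -- (1) `Q⁷ ≤ x^{θ/16}`
  have hQ7 : Q ^ (7 : ℕ) ≤ x ^ (θ / 16) := by
    have h1 : (Q ^ a₁) ^ (7 / a₁) ≤ x ^ (7 / a₁) :=
      Real.rpow_le_rpow (by positivity) hx (by positivity)
    have h2 : (Q ^ a₁) ^ (7 / a₁) = Q ^ (7 : ℕ) := by
      rw [← Real.rpow_mul hQ0.le, show a₁ * (7 / a₁) = ((7 : ℕ) : ℝ) by field_simp; norm_num,
        Real.rpow_natCast]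
    have h3 : x ^ (7 / a₁) ≤ x ^ (θ / 16) := by
      refine Real.rpow_le_rpow_of_exponent_le hx1 ?_
      rw [div_le_div_iff₀ (by linarith) (by norm_num)]
      have : 112 / θ * θ = 112 := by field_simp
      nlinarith
    rw [h2] at h1
    exact h1.trans h3
  -- (2) `L + 1 ≤ (16/θ) x^{θ/16}`
  have hLpow : L + 1 ≤ 16 / θ * x ^ (θ / 16) := by
    have hp : 0 < x ^ (θ / 16) := Real.rpow_pos_of_pos hx0 _
    have h1 := Real.log_le_sub_one_of_pos hp
    rw [Real.log_rpow hx0, ← hL] at h1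
    -- `(θ/16) L ≤ x^{θ/16} − 1`, so `L + 16/θ ≤ (16/θ) x^{θ/16}` and `1 ≤ 16/θ`
    have h16 : 1 ≤ 16 / θ := by rw [le_div_iff₀ hθ]; linarith
    have h2 : L + 16 / θ ≤ 16 / θ * x ^ (θ / 16) := by
      have := mul_le_mul_of_nonneg_left h1 (show (0:ℝ) ≤ 16 / θ by positivity)
      have e1 : 16 / θ * (θ / 16 * L) = L := by field_simp
      rw [mul_sub, e1, mul_one] at this
      linarith
    linarith
  -- (3) `x^{θ/8} ≥ 16C/θ + 1`
  have hxθ : 16 * C / θ + 1 ≤ x ^ (θ / 8) := by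
    have h1 : Real.log (16 * C / θ + 1) ≤ θ / 8 * L := by
      have h2 : 4 / θ * Real.log (16 * C / θ + 1) * Real.log Q ≤ L := by
        have := mul_le_mul_of_nonneg_right halog (by linarith : (0:ℝ) ≤ Real.log Q)
        linarith
      have hl0 : 0 ≤ Real.log (16 * C / θ + 1) := Real.log_nonneg (by
        have : 0 ≤ 16 * C / θ := by positivity
        linarith)
      have h3 : 4 / θ * Real.log (16 * C / θ + 1) * 2 ≤ L := by nlinarith
      have e : θ / 8 * (4 / θ * Real.log (16 * C / θ + 1) * 2) = Real.log (16 * C / θ + 1) := by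
        field_simp; ring
      have := mul_le_mul_of_nonneg_left h3 (by positivity : (0:ℝ) ≤ θ / 8)
      rw [e] at this; exact this
    have h4 : Real.exp (Real.log (16 * C / θ + 1)) ≤ Real.exp (θ / 8 * L) := Real.exp_le_exp.2 h1
    rw [Real.exp_log (by positivity), hL, show θ / 8 * Real.log x = Real.log x * (θ / 8) by ring,
      ← Real.rpow_def_of_pos hx0] at h4
    exact h4
  -- assemble: `C Q⁷ (L+1) x^{−θ/4} ≤ C x^{θ/16} (16/θ) x^{θ/16} x^{−θ/4} = (16C/θ) x^{−θ/8} ≤ 1`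
  have hx8 : 0 < x ^ (θ / 8) := Real.rpow_pos_of_pos hx0 _
  have hprod : x ^ (θ / 16) * x ^ (θ / 16) * x ^ (-(θ / 4)) * x ^ (θ / 8) = 1 := by
    rw [← Real.rpow_add hx0, ← Real.rpow_add hx0, ← Real.rpow_add hx0]
    rw [show θ / 16 + θ / 16 + -(θ / 4) + θ / 8 = 0 by ring, Real.rpow_zero]
  have hmain : C * Q ^ (7 : ℕ) * (L + 1) * x ^ (-(θ / 4)) * x ^ (θ / 8) ≤ 16 * C / θ := by
    calc C * Q ^ (7 : ℕ) * (L + 1) * x ^ (-(θ / 4)) * x ^ (θ / 8)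
        ≤ C * x ^ (θ / 16) * (16 / θ * x ^ (θ / 16)) * x ^ (-(θ / 4)) * x ^ (θ / 8) := by
          have h0 : 0 ≤ x ^ (-(θ / 4)) * x ^ (θ / 8) := by positivity
          have h1 : C * Q ^ (7 : ℕ) * (L + 1) ≤ C * x ^ (θ / 16) * (16 / θ * x ^ (θ / 16)) :=
            mul_le_mul (mul_le_mul_of_nonneg_left hQ7 hC) hLpow (by linarith) (by positivity)
          calc C * Q ^ (7 : ℕ) * (L + 1) * x ^ (-(θ / 4)) * x ^ (θ / 8)
              = (C * Q ^ (7 : ℕ) * (L + 1)) * (x ^ (-(θ / 4)) * x ^ (θ / 8)) := by ring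
            _ ≤ (C * x ^ (θ / 16) * (16 / θ * x ^ (θ / 16))) * (x ^ (-(θ / 4)) * x ^ (θ / 8)) :=
                mul_le_mul_of_nonneg_right h1 h0
            _ = _ := by ring
      _ = 16 * C / θ * (x ^ (θ / 16) * x ^ (θ / 16) * x ^ (-(θ / 4)) * x ^ (θ / 8)) := by ring
      _ = 16 * C / θ := by rw [hprod, mul_one]
  -- divide by `x^{θ/8} ≥ 16C/θ + 1`
  by_contra hgt
  rw [not_le] at hgt
  have : 16 * C / θ + 1 < C * Q ^ (7 : ℕ) * (L + 1) * x ^ (-(θ / 4)) * x ^ (θ / 8) := by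
    calc 16 * C / θ + 1 ≤ x ^ (θ / 8) := hxθ
      _ = 1 * x ^ (θ / 8) := (one_mul _).symm
      _ < C * Q ^ (7 : ℕ) * (L + 1) * x ^ (-(θ / 4)) * x ^ (θ / 8) :=
          mul_lt_mul_of_pos_right hgt hx8
  linarith

end Summit.QuantumAdvantage.QuantumAdvantage.Theorems.DegreeOnePrimesEscape

end
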